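import Mathlib

/-!
# ζ(5) search — DENOM-LAW D1: the HERMITE RESIDUE SUM (residue theorem on `ℙ¹` for poles of order `≤ 2`), kernel version

Cell `pub-zeta5`, track DENOM-LAW (D1), K1 typing order item (2) «Theorem M residue identity», part 1 of 2.
HONEST FRAMING: systematic search; this file is PURE ALGEBRA over an arbitrary field — the classical fact that the
residues of a rational function `A/D` on the projective line sum to zero, in the explicit Lagrange–Hermite form for a
denominator `D = ∏_{w∈S} (X − w)^{m_w}` with `m_w ∈ {1, 2}` (the only pole orders the DENOM-LAW moment law needs);
it is the engine under THEOREM M of `denom-law/theory-d1g9/MU-LAW-PROOF.md` (denom-theory-d1 g9), whose product /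
moment form is the sibling file `DenomLaw/MomentLaw.lean`.  Nothing here is about ζ(5); no `p`-adic digit of a linear
form is computed; no γ; no irrationality claim; records in print UNMOVED.  (Classical material; a literature seat may
re-home it under `Literature/Algebra/Polynomial/` — the statements are self-contained and import only Mathlib.)

## Content

* `nodePoly S m = ∏_{w ∈ S} (X − w)^{m w}`, its degree / evaluation / divisibility / logarithmic derivative
  (`eval_derivative_nodePoly`: `D'(z) = D(z) Σ_w m_w/(z − w)` off the nodes).
* `nodeResidue S m A z`: the RESIDUE of `A / nodePoly S m` at the node `z` in closed form — `A(z)/D_z(z)` at a simple node,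
  `(A/D_z)'(z) = (A'(z) D_z(z) − A(z) D_z'(z))/D_z(z)²` at a double node (`D_z = nodePoly (S ∖ {z}) m` the cofactor).
* `hermiteInterp S m A`: the explicit Hermite interpolant `Σ_z (A(z)/D_z(z)) D_z + Σ_{z double} Res_z (X − z) D_z`; it has degree
  `< M := Σ m`, the values of `A` at all nodes and the first derivatives of `A` at the double nodes, hence (`D ∣ A − H`,
  `deg < deg D`) `hermiteInterp_eq`: it EQUALS `A` when `deg A < M`.
* `hermite_residue_sum`: for `deg A < M`, `Σ_{z∈S} nodeResidue S m A z = [X^{M−1}] A` (= minus the residue at infinity);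
  `hermite_residue_sum_eq_zero`: the residue sum VANISHES when `deg A ≤ M − 2`.
-/

open Polynomial Finset

namespace Summit.KontsevichZagierPeriods.Zeta5Search.DenomLaw.MomentLaw

variable {F : Type*} [Field F]

/-! ### Nodal polynomials -/

/-- The NODAL POLYNOMIAL `∏_{w ∈ S} (X − w)^{m w}` of a finite node set `S` with multiplicities `m`. -/
noncomputable def nodePoly (S : Finset F) (m : F → ℕ) : F[X] := ∏ w ∈ S, (X - C w) ^ m w

/-- The nodal polynomial is monic. -/
theorem nodePoly_monic (S : Finset F) (m : F → ℕ) : (nodePoly S m).Monic :=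
  monic_prod_of_monic _ _ fun w _ => (monic_X_sub_C w).pow _

/-- The nodal polynomial is non-zero. -/
theorem nodePoly_ne_zero (S : Finset F) (m : F → ℕ) : nodePoly S m ≠ 0 := (nodePoly_monic S m).ne_zero

/-- `deg nodePoly = Σ m`. -/
theorem natDegree_nodePoly (S : Finset F) (m : F → ℕ) : (nodePoly S m).natDegree = ∑ w ∈ S, m w := by
  unfold nodePoly
  rw [natDegree_prod_of_monic _ _ (fun w _ => (monic_X_sub_C w).pow _)]
  refine sum_congr rfl fun w _ => ?_
  rw [(monic_X_sub_C w).natDegree_pow, natDegree_X_sub_C, mul_one]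

/-- `deg nodePoly = Σ m` (as a `WithBot ℕ` degree). -/
theorem degree_nodePoly (S : Finset F) (m : F → ℕ) : (nodePoly S m).degree = (∑ w ∈ S, m w : ℕ) := by
  rw [degree_eq_natDegree (nodePoly_ne_zero S m), natDegree_nodePoly]

/-- Evaluation of the nodal polynomial. -/
theorem eval_nodePoly (S : Finset F) (m : F → ℕ) (z : F) :
    (nodePoly S m).eval z = ∏ w ∈ S, (z - w) ^ m w := by
  unfold nodePoly
  rw [eval_prod]
  refine prod_congr rfl fun w _ => ?_
  rw [eval_pow, eval_sub, eval_X, eval_C]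

/-- Off the nodes the nodal polynomial does not vanish. -/
theorem eval_nodePoly_ne_zero (S : Finset F) (m : F → ℕ) {z : F} (hz : z ∉ S) :
    (nodePoly S m).eval z ≠ 0 := by
  rw [eval_nodePoly]
  exact prod_ne_zero_iff.mpr fun w hw => pow_ne_zero _ (sub_ne_zero.mpr fun h => hz (h ▸ hw))

/-- `(X − w)^{m w}` divides the nodal polynomial for every node `w`. -/
theorem pow_dvd_nodePoly (S : Finset F) (m : F → ℕ) {w : F} (hw : w ∈ S) : (X - C w) ^ m w ∣ nodePoly S m :=
  dvd_prod_of_mem _ hw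

/-- A polynomial divisible by `(X − w)^k`, `k ≥ 1`, vanishes at `w`. -/
theorem eval_eq_zero_of_pow_dvd {P : F[X]} {w : F} {k : ℕ} (hk : 1 ≤ k) (h : (X - C w) ^ k ∣ P) :
    P.eval w = 0 := by
  obtain ⟨Q, rfl⟩ := h
  rw [eval_mul, eval_pow, eval_sub, eval_X, eval_C, sub_self, zero_pow (by omega), zero_mul]

/-- A polynomial divisible by `(X − w)^k`, `k ≥ 2`, has vanishing derivative at `w`. -/
theorem eval_derivative_eq_zero_of_pow_dvd {P : F[X]} {w : F} {k : ℕ} (hk : 2 ≤ k) (h : (X - C w) ^ k ∣ P) :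
    (derivative P).eval w = 0 := by
  obtain ⟨Q, rfl⟩ := h
  rw [derivative_mul, derivative_X_sub_C_pow, eval_add, eval_mul, eval_mul, eval_mul, eval_C, eval_pow, eval_pow,
    eval_sub, eval_X, eval_C, sub_self, zero_pow (by omega), zero_pow (by omega)]
  ring

/-- The nodal polynomial is a product of pairwise coprime prime powers, so it divides whatever each of them divides. -/
theorem nodePoly_dvd (S : Finset F) (m : F → ℕ) {P : F[X]} (h : ∀ w ∈ S, (X - C w) ^ m w ∣ P) : nodePoly S m ∣ P := by
  refine Finset.prod_dvd_of_coprime (fun w _ w' _ hne => ?_) h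
  exact (pairwise_coprime_X_sub_C (K := F) Function.injective_id hne).pow

variable [DecidableEq F]

/-- Splitting off one node: `nodePoly S m = (X − z)^{m z} · nodePoly (S ∖ {z}) m`. -/
theorem nodePoly_eq_mul_erase (S : Finset F) (m : F → ℕ) {z : F} (hz : z ∈ S) :
    nodePoly S m = (X - C z) ^ m z * nodePoly (S.erase z) m := by
  unfold nodePoly
  rw [mul_prod_erase S (fun w => (X - C w) ^ m w) hz]

/-- LOGARITHMIC DERIVATIVE of the nodal polynomial off the nodes: `D'(z) = D(z) · Σ_w m_w/(z − w)`. -/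
theorem eval_derivative_nodePoly (S : Finset F) (m : F → ℕ) {z : F} (hz : z ∉ S) :
    (derivative (nodePoly S m)).eval z = (nodePoly S m).eval z * ∑ w ∈ S, (m w : F) / (z - w) := by
  unfold nodePoly
  rw [derivative_prod_finset, eval_finsetSum, eval_prod, mul_sum]
  refine sum_congr rfl fun w hw => ?_
  have hzw : z - w ≠ 0 := sub_ne_zero.mpr fun h => hz (h ▸ hw)
  rw [← mul_prod_erase S (fun v => eval z ((X - C v) ^ m v)) hw, eval_mul, derivative_X_sub_C_pow, eval_mul, eval_C,
    eval_prod, eval_pow, eval_pow, eval_sub, eval_X, eval_C]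
  rcases Nat.eq_zero_or_pos (m w) with h0 | hpos
  · rw [h0]; simp
  · obtain ⟨k, hk⟩ := Nat.exists_eq_add_of_le hpos
    rw [hk, Nat.add_sub_cancel_left, add_comm 1 k, pow_succ]
    field_simp

/-! ### Residues and the Hermite residue sum -/

/-- The RESIDUE of `A / nodePoly S m` at the node `z` (multiplicity `m z ∈ {1,2}`), in closed form: with the cofactor
`D_z := nodePoly (S ∖ {z}) m`, it is `A(z)/D_z(z)` at a simple node and `(A/D_z)'(z) = (A'(z) D_z(z) − A(z) D_z'(z))/D_z(z)²`
at a double node. -/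
noncomputable def nodeResidue (S : Finset F) (m : F → ℕ) (A : F[X]) (z : F) : F :=
  if m z = 1 then A.eval z / (nodePoly (S.erase z) m).eval z
  else (A.derivative.eval z * (nodePoly (S.erase z) m).eval z
          - A.eval z * (derivative (nodePoly (S.erase z) m)).eval z) / ((nodePoly (S.erase z) m).eval z) ^ 2

/-- The explicit HERMITE INTERPOLANT of `A` on the nodes (values at all nodes, first derivatives at double nodes):
`Σ_z (A(z)/D_z(z)) · D_z + Σ_{z double} Res_z · (X − z) D_z`. -/
noncomputable def hermiteInterp (S : Finset F) (m : F → ℕ) (A : F[X]) : F[X] :=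
  ∑ z ∈ S, (C (A.eval z / (nodePoly (S.erase z) m).eval z) * nodePoly (S.erase z) m
    + C (if m z = 1 then 0 else nodeResidue S m A z) * ((X - C z) * nodePoly (S.erase z) m))

section Hermite

variable (S : Finset F) (m : F → ℕ) (A : F[X])

/-- Each node's cofactor does not vanish at that node. -/
theorem eval_cofactor_ne_zero (z : F) : (nodePoly (S.erase z) m).eval z ≠ 0 :=
  eval_nodePoly_ne_zero _ _ (notMem_erase z S)

/-- Degree bookkeeping of the cofactor: `deg D_z + m z = M`. -/
theorem natDegree_cofactor {z : F} (hz : z ∈ S) :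
    (nodePoly (S.erase z) m).natDegree + m z = ∑ w ∈ S, m w := by
  rw [natDegree_nodePoly, add_comm, add_sum_erase S m hz]

/-- The Hermite interpolant has degree `< M = Σ m`. -/
theorem degree_hermiteInterp_lt (hm : ∀ z ∈ S, m z = 1 ∨ m z = 2) :
    (hermiteInterp S m A).degree < (∑ w ∈ S, m w : ℕ) := by
  rw [← mem_degreeLT]
  unfold hermiteInterp
  refine Submodule.sum_mem _ fun z hz => Submodule.add_mem _ ?_ ?_
  · rw [← smul_eq_C_mul]
    refine Submodule.smul_mem _ _ (mem_degreeLT.mpr ?_)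
    rw [degree_eq_natDegree (nodePoly_ne_zero _ _), Nat.cast_lt, ← natDegree_cofactor S m hz]
    rcases hm z hz with h | h <;> omega
  · rcases hm z hz with h | h
    · rw [if_pos h, C_0, zero_mul]
      exact Submodule.zero_mem _
    · rw [← smul_eq_C_mul]
      refine Submodule.smul_mem _ _ (mem_degreeLT.mpr ?_)
      rw [degree_eq_natDegree (mul_ne_zero (X_sub_C_ne_zero z) (nodePoly_ne_zero _ _)),
        natDegree_mul (X_sub_C_ne_zero z) (nodePoly_ne_zero _ _), natDegree_X_sub_C, Nat.cast_lt,
        ← natDegree_cofactor S m hz]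
      omega

/-- The Hermite interpolant takes the value `A(w)` at every node `w`. -/
theorem eval_hermiteInterp (hm : ∀ z ∈ S, m z = 1 ∨ m z = 2) {w : F} (hw : w ∈ S) :
    (hermiteInterp S m A).eval w = A.eval w := by
  unfold hermiteInterp
  rw [eval_finsetSum, sum_eq_single_of_mem w hw]
  · rw [eval_add, eval_mul, eval_C, eval_mul, eval_C, eval_mul, eval_sub, eval_X, eval_C, sub_self, zero_mul,
      mul_zero, add_zero, div_mul_cancel₀ _ (eval_cofactor_ne_zero S m w)]
  · intro z _ hzw
    have hdvd : (X - C w) ^ m w ∣ nodePoly (S.erase z) m :=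
      pow_dvd_nodePoly _ _ (mem_erase.mpr ⟨fun h => hzw h.symm, hw⟩)
    have hmw : 1 ≤ m w := by rcases hm w hw with h | h <;> omega
    have h0 : (nodePoly (S.erase z) m).eval w = 0 := eval_eq_zero_of_pow_dvd hmw hdvd
    rw [eval_add, eval_mul, eval_mul, eval_mul, h0, mul_zero, mul_zero, mul_zero, add_zero]

/-- The Hermite interpolant has derivative `A'(w)` at every double node `w`. -/
theorem eval_derivative_hermiteInterp {w : F} (hw : w ∈ S) (h2 : m w = 2) :
    (derivative (hermiteInterp S m A)).eval w = (derivative A).eval w := by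
  unfold hermiteInterp
  rw [derivative_sum, eval_finsetSum, sum_eq_single_of_mem w hw]
  · have hD : (nodePoly (S.erase w) m).eval w ≠ 0 := eval_cofactor_ne_zero S m w
    rw [if_neg (by omega)]
    unfold nodeResidue
    rw [if_neg (by omega)]
    rw [derivative_add, derivative_mul, derivative_C, zero_mul, zero_add, derivative_mul, derivative_C, zero_mul,
      zero_add, derivative_mul, derivative_sub, derivative_X, derivative_C, sub_zero, one_mul]
    rw [eval_add, eval_mul, eval_C, eval_mul, eval_C, eval_add, eval_mul, eval_sub, eval_X, eval_C, sub_self,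
      zero_mul, add_zero]
    field_simp
    ring
  · intro z _ hzw
    have hdvd : (X - C w) ^ m w ∣ nodePoly (S.erase z) m :=
      pow_dvd_nodePoly _ _ (mem_erase.mpr ⟨fun h => hzw h.symm, hw⟩)
    refine eval_derivative_eq_zero_of_pow_dvd (k := m w) (by omega) ?_
    exact dvd_add (dvd_mul_of_dvd_right hdvd _) (dvd_mul_of_dvd_right (dvd_mul_of_dvd_right hdvd _) _)

/-- **Hermite interpolation**: a polynomial of degree `< M` IS its Hermite interpolant on the nodes. -/
theorem hermiteInterp_eq (hm : ∀ z ∈ S, m z = 1 ∨ m z = 2) (hA : A.degree < (∑ w ∈ S, m w : ℕ)) :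
    hermiteInterp S m A = A := by
  have hdvd : nodePoly S m ∣ A - hermiteInterp S m A := by
    refine nodePoly_dvd S m fun w hw => ?_
    by_cases h0 : A - hermiteInterp S m A = 0
    · rw [h0]; exact dvd_zero _
    rw [← le_rootMultiplicity_iff h0]
    have hroot : (A - hermiteInterp S m A).IsRoot w := by
      rw [IsRoot, eval_sub, eval_hermiteInterp S m A hm hw, sub_self]
    rcases hm w hw with h | h
    · rw [h]; exact (rootMultiplicity_pos h0).mpr hroot
    · rw [h]
      refine (one_lt_rootMultiplicity_iff_isRoot h0).mpr ⟨hroot, ?_⟩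
      rw [IsRoot, derivative_sub, eval_sub, eval_derivative_hermiteInterp S m A hw h, sub_self]
  have hdeg : (A - hermiteInterp S m A).degree < (nodePoly S m).degree := by
    rw [degree_nodePoly]
    exact (degree_sub_le _ _).trans_lt (max_lt hA (degree_hermiteInterp_lt S m A hm))
  exact (sub_eq_zero.mp (eq_zero_of_dvd_of_degree_lt hdvd hdeg)).symm

/-- The `y^{M−1}`-coefficient of the Hermite interpolant is the sum of the residues. -/
theorem coeff_hermiteInterp (hm : ∀ z ∈ S, m z = 1 ∨ m z = 2) :
    (hermiteInterp S m A).coeff (∑ w ∈ S, m w - 1) = ∑ z ∈ S, nodeResidue S m A z := by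
  unfold hermiteInterp
  rw [finsetSum_coeff]
  refine sum_congr rfl fun z hz => ?_
  have hdeg := natDegree_cofactor S m hz
  have hmon : (nodePoly (S.erase z) m).Monic := nodePoly_monic _ _
  have hmon' : ((X - C z) * nodePoly (S.erase z) m).Monic := (monic_X_sub_C z).mul hmon
  have hdeg' : ((X - C z) * nodePoly (S.erase z) m).natDegree = (nodePoly (S.erase z) m).natDegree + 1 := by
    rw [natDegree_mul (X_sub_C_ne_zero z) (nodePoly_ne_zero _ _), natDegree_X_sub_C, add_comm]
  rw [coeff_add, coeff_C_mul, coeff_C_mul]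
  rcases hm z hz with h | h
  · have e : ∑ w ∈ S, m w - 1 = (nodePoly (S.erase z) m).natDegree := by omega
    rw [if_pos h, zero_mul, add_zero, e, hmon.coeff_natDegree, mul_one]
    unfold nodeResidue
    rw [if_pos h]
  · have e : ∑ w ∈ S, m w - 1 = ((X - C z) * nodePoly (S.erase z) m).natDegree := by omega
    rw [if_neg (by omega), coeff_eq_zero_of_natDegree_lt (by omega), mul_zero, zero_add, e,
      hmon'.coeff_natDegree, mul_one]

/-- **THE HERMITE RESIDUE SUM** (residue theorem on `ℙ¹` for `A / ∏ (X − w)^{m w}`, `m w ∈ {1,2}`, `deg A < M = Σ m`):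
the sum of the finite residues equals the `y^{M−1}`-coefficient of `A` (= minus the residue at infinity). -/
theorem hermite_residue_sum (hm : ∀ z ∈ S, m z = 1 ∨ m z = 2) (hA : A.degree < (∑ w ∈ S, m w : ℕ)) :
    ∑ z ∈ S, nodeResidue S m A z = A.coeff (∑ w ∈ S, m w - 1) := by
  rw [← coeff_hermiteInterp S m A hm, hermiteInterp_eq S m A hm hA]

/-- **THE HERMITE RESIDUE SUM VANISHES** when `deg A ≤ M − 2`. -/
theorem hermite_residue_sum_eq_zero (hm : ∀ z ∈ S, m z = 1 ∨ m z = 2) (hA : A.natDegree + 2 ≤ ∑ w ∈ S, m w) :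
    ∑ z ∈ S, nodeResidue S m A z = 0 := by
  have hA' : A.degree < (∑ w ∈ S, m w : ℕ) :=
    degree_le_natDegree.trans_lt (by exact_mod_cast (by omega : A.natDegree < ∑ w ∈ S, m w))
  rw [hermite_residue_sum S m A hm hA', coeff_eq_zero_of_natDegree_lt (by omega)]

end Hermite

end Summit.KontsevichZagierPeriods.Zeta5Search.DenomLaw.MomentLaw
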